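import Literature.MathematicalPhysics.QuantumFieldTheory.Balaban1983to89.B2Eq37QuadraticForm
import Literature.MathematicalPhysics.QuantumFieldTheory.Balaban1983to89.B2Eq243RegionsTower
import Literature.MathematicalPhysics.QuantumFieldTheory.Balaban1983to89.B2Eq32FieldRegularity
import Literature.MathematicalPhysics.QuantumFieldTheory.Balaban1983to89.B2Eq28RegionsCollars

/-!
# `Balaban1983to89.B2Eq37RemainingIntegralTower` — T. Bałaban, *(Higgs)₂,₃ quantum fields in a finite volume. II. An upper bound*,
Commun. Math. Phys. **86** (1982) 555–594 [Balaban1982Higgs2] p. 584 [PDF 30]: **the remaining integral (3.7) ON PRINT'S OWN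
TOWER OF REGIONS** — p23 g25's concrete display `B2Eq37RemainingIntegral.Data37.display37` with its geometry INSTANTIATED
from the tree's constructions: the (3.9)-geometry of Bałaban's runs `Geom39.ofTower` (p23 g11 v1.1) over the tower of
small-field regions `B2Eq243RegionsTower.towerOf` built from the large-field points of every step (typer g9), the masks
`Λ₆^{(k−1)′} = (Λ₆^{(k−1)})′`, `Λ₇^{(k−1)′} = (Λ₇^{(k−1)})′`, the Neumann region `Bᵏ(Λ₂^{(k−1)′})` and the (3.4) fields `Ã⁽ᵏ⁾`,
`Ã^{(k+1)}` (p23 g10 `field34`) — so that the set hypotheses of `display37_factor` (p23 g25) and of `exponent37_split` /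
`display37_gaussian` (p23 g26 `B2Eq37QuadraticForm`) are THEOREMS for Bałaban's runs: `Λ₅⁽ᵏ⁾ ⊂ Λ₇^{(k−1)′} ⊂ Λ₆^{(k−1)′}` from
(2.8) and p. 566 *"Λ₀^{(j+1)} ⊂ Λ₇^{(j)′}"* (`Λ5_subset_R7p`, `R7p_subset_R6p`, `Λ5_subset_R6p`), and the three statements hold
UNCONDITIONALLY (`display37_factor_tower`, `exponent37_split_tower`, `display37_gaussian_tower`)

statement-level skeleton of published theorems with citation tags; proofs where landed; nothing here is a claim about the Yang–Mills mass gap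

PDF held: `paper:balaban1982-cmp86-higgs23-ii` (journal page = PDF page + 554); pp. 558, 566, 583–585 [PDF 4, 12, 29–31] as
read for `B2Eq37RemainingIntegral` (p23 g25, render `lit-balaban-p23/lean/B2-p584-PDF30-x2.5.png`), `B2Eq243RegionsTower` (typer
g9, renders p012/p016) and `B2Eq32FieldRegularity` (p23 g10); nothing is re-read here (v1.0); v1.1 re-read p. 558 [PDF 4] as
image (render `…/1982-cmp86-higgs23-II-p004-x2.png` of the b2b reference pages) for the (2.8) sentence quoted below.

VERSIONS.  v1.0 = p381553 (p23 gen 26).  v1.1 (p23 gen 28, DOC-ONLY): in THE SOURCE TEXT paragraph the inductive definition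
(2.8) of p. 558 is now quoted verbatim and the chain `Λ₇ ⊂ Λ₆ ⊂ ⋯ ⊂ Λ₀` is named as its consequence (`towerRegion_antitone`)
instead of standing in quotation marks — second reader r14 (SECONDREAD-B2 v65) note N-r14-g24-2; nothing else changed (no
declaration, statement or proof touched).

CITATION HEADER (lean-in-tree rule).  lit-balaban typed skeleton (HOME `run/shared/lean/pub/lit-balaban/`), Phase-2 proof
seat **p23** gen 26 (unit `lit-balaban-p23-g26`; TAKING #1 line HOME/STATUS.md 2026-08-23T20:43:27Z; item (i) of HOME/HANDOFF
§ «lit-balaban-p23 gen 25»: *"companion discharging the one hypothesis `Λ₅⁽ᵏ⁾ ⊆ Λ₇^{(k−1)′}` of `display37_factor` for the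
(2.43) tower and instantiating `Data37` from the tree's constructions"*).  SKELETON row **B2.Eq3.1-3.10** (owner r02, second
reader r14, referee ref-4) — a CELLS-ONLY companion of the member (3.7) (p23 g25 p371416); no head change is claimed.  The
pattern is p23 g15's `B2Ineq2109HiggsLatticeTower.TowerData.toInst` ((2.108) with the constructed sets) and p23 g11's
`Geom39.ofTower`.  USED BY NAME, NOTHING RESTATED: `B2Eq37RemainingIntegral.{Data37, display37, display37_factor, exponent37,
chiProd37, fld37}` (p23 g25), `B2Eq37QuadraticForm.{lin37, quad37, exponent37_split, display37_gaussian}` (p23 g26),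
`B2Eq39ConcreteForms.Geom39.ofTower` (p23 g11), the typer's `B2Eq243RegionsTower.{towerRegion, towerOf, towerOf_lam_of_lt,
towerOf_lam_of_not_lt, towerRegion_antitone, towerRegion_succ_subset_prime, towerRegion_eq_univ_of_no_bad, prime_univ}` and
`B2Eq28RegionsCollars.prime_mono`, p15's `B2Eq324NestedRegions.{prime, Tower}`, `B2Eq255Concrete.{underRegion,
mem_underRegion, cutTo}` (`Bᵏ(·)`), p23 g10's `B2Eq32FieldRegularity.field34` ((3.4)), `HiggsCondGauss228.{fieldOfCrd, inSet}`,
`B2Eq228Conditioning.In`.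

THE SOURCE TEXT (verbatim; the display (3.7) is in `B2Eq37RemainingIntegral`'s header).  p. 584: the integral (3.7) carries
`ρ′⁽ᵏ⁾(Λ₀⁽⁰⁾, …, Λ₀^{(k−1)}, Λ₇^{(k−1)′c}A_k, Ã⁽ᵏ⁾, Λ₇^{(k−1)′c}φ_k)`, the masks `Λ₆^{(k−1)′}` on the three operator lines, the operator
`Δ⁽ᵏ⁾(Bᵏ(Λ₂^{(k−1)′}), Ã⁽ᵏ⁾)` and the averagings `Q_{l−k}(Ã^{(k+1)})`.  p. 583 (3.4): *"Ã^{(k),ε} = Σ_{l=k}^{K−1}(1 − θ_{l+1})θ_lA^{(l),ε} +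
θ_KA^{(K),ε}"*.  p. 558 (2.8): *"Next let us define a sequence of sets Λ₁, Λ₂, … by an induction[:] Λ^c_{i+1} is the sum of all
large blocks of T₁ with distances from the set Λ^c_i less or equal r(ε)."* — so `Λ^c_i ⊂ Λ^c_{i+1}`, i.e. the chain
`Λ₇ ⊂ Λ₆ ⊂ Λ₅ ⊂ ⋯ ⊂ Λ₀` used below is a CONSEQUENCE of (2.8) (the typer's `B2Eq243RegionsTower.towerRegion_antitone`), not a
printed display (with `r(Lʲε)` at step `j + 1`, p. 566 *"Of course the sets Λ_i^{(j)} are defined in the same way as Λ_i, r(ε) is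
replaced by r(Lʲε) only"*).  p. 566: *"In general Λ₀^{(j+1)} ⊂ Λ₇^{(j)′}"*; *"We will use
the same notations for the sets in different scales"* (the primed sets `Λ′ ⊂ T^{(j+1)}`: `y ∈ Λ′ ⇔ B(y) ⊂ Λ`, p15's `prime`).
p. 588 (3.23): *"where Λ₅^{(K)} = ∅"*.  p. 570: *"Bᵏ(Λ₂^{(k−1)′})"* = the fine sites whose `k`-block point lies in `Λ₂^{(k−1)′}`.

DICTIONARY (print ↦ Lean; step `k = j + 1`, `1 ≤ k ≤ K ≤ P.K`).  The large-field points of every step ↦ `bad`, the radii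
`r(Lˡε)` ↦ `rad l ≥ 0` (data, as in `B2Eq243RegionsTower`/`TowerData`); `Λ_i^{(l)}` ↦ `towerRegion bad rad l i`; the §3 tower
`Λ₅^{(0)}, …, Λ₅^{(K−1)}, Λ₅^{(K)} = ∅` ↦ `towerOf bad rad hrad K`; `Λ₅⁽ᵏ⁾`, `Λ₅^{(k−1)′}`, the pieces `Λ₅^{(l−1)′}∩Λ₅^{(l)c}` ↦
`Geom39.ofTower (towerOf …) hK j hj`; `Λ₆^{(k−1)′}` ↦ `prime (towerRegion bad rad j 6)`, `Λ₇^{(k−1)′}` ↦ `prime (towerRegion bad rad j 7)`;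
`Bᵏ(Λ₂^{(k−1)′})` ↦ `underRegion (j+1) (prime (towerRegion bad rad j 2))`; `Ã⁽ᵏ⁾`, `Ã^{(k+1)}` ↦ `field34 θ A (j+1) K`,
`field34 θ A (j+2) K` (cut-offs `θ_l` and minimizers `A^{(l),ε}` as data, p23 g10's reading); the fields `A_k, φ_k, A_l, φ_l`,
the characteristic functions, `ρ′⁽ᵏ⁾` and `H_k` stay NAMED DATA (`TowerInput37`), exactly as in `Data37`/`Data245`.

WHAT IS PROVED (kernel-checked, 0 `sorry`, standard axioms; DEFINITIONS WITH BODY (`TowerInput37`, `toData37`) + theorems;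
NO `Prop`-valued fact).
 §1 `field34_succ` ((3.4) one step down: `Ã⁽ᵏ⁾ = (1 − θ_{k+1})θ_kA⁽ᵏ⁾ + Ã^{(k+1)}`, `k < K`), `field34_self` (`Ã⁽ᴷ⁾ = θ_KA⁽ᴷ⁾`).
 §2 `TowerInput37`, **`toData37`**; the dictionary lemmas `toData37_G/_j/_M/_Λ5/_Λc/_R6p/_R7p/_Ω/_Atk/_Atk1` (rfl), `mem_Ω`,
    `Λ5_eq_of_lt` (`Λ₅⁽ᵏ⁾ = towerRegion … 5` for `k < K`), `Λ5_eq_empty_of_eq` (`Λ₅⁽ᴷ⁾ = ∅`).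
 §3 THE NESTINGS: **`Λ5_subset_R7p`** (`Λ₅⁽ᵏ⁾ ⊆ Λ₇^{(k−1)′}`), **`R7p_subset_R6p`**, **`Λ5_subset_R6p`**, `R6p_subset_L2p`
    (`Λ₆^{(k−1)′} ⊆ Λ₂^{(k−1)′}`), **`under_Λ5_subset_Ω`** (`Bᵏ(Λ₅⁽ᵏ⁾) ⊆ Bᵏ(Λ₂^{(k−1)′})`: the integrated scalar field lives inside
    the Neumann region).
 §4 UNCONDITIONAL forms for Bałaban's runs: **`display37_factor_tower`**, **`exponent37_split_tower`**, **`display37_gaussian_tower`**.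
 §5 Non-vacuity: `trivialInput` / `exists_towerInput37` (every `K ≤ P.K`, `1 ≤ k ≤ K`), `Λ5_eq_univ_of_no_bad` (no large field
    at any step ⇒ `Λ₅⁽ᵏ⁾ = T⁽ᵏ⁾` for `k < K`).
HONEST SCOPE.  (a) Which points are bad at each step and the radii are DATA (the characteristic functions (2.4)–(2.6)/(2.53)
decide them; `B2Eq243RegionsTower` HONEST SCOPE (a)); the value here is that the deterministic geometry of (3.7) downstream of
them is the tree's construction and its two nestings are theorems.  (b) Fields, characteristic functions, `ρ′⁽ᵏ⁾`, `H_k` remain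
named data: `H_k` of record is p23 g15's coordinate matrix `B2Ineq2109HiggsLattice.Inst.Hk` on `Λ₆^{(k−1)′} × {1,…,N}` — reading
it as the linear operator `Data37.Hk` is a coordinate dictionary not done here; `ρ′⁽ᵏ⁾` is (2.47)–(2.50) (r14's schematic
`B2Sect2BDensities`), the `χ`'s are (2.4)–(2.6)′/(2.53).  (c) `θ_l`, `A^{(l),ε}` enter (3.4) as data (p23 g10's reading: the
cut-off acts through the bond's initial point); their constructions are `B2Eq244Cutoff`/`B2Eq245Theta` and row B2.Eq2.44.
(d) Everything of `B2Eq37RemainingIntegral`/`B2Eq37QuadraticForm` HONEST SCOPE applies verbatim (display, not inequality; the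
(2.49)/(2.46) step to (3.9) not claimed; physical units; `1 ≤ k ≤ K`).  Value = the remaining integral of §3.A on the regions
Bałaban actually sums over, with its structural sentences hypothesis-free; NOT summit progress.  No row head change (owner r02).
-/

noncomputable section

open scoped BigOperators InnerProductSpace
open MeasureTheory

namespace Literature.MathematicalPhysics.QuantumFieldTheory.Balaban1983to89.B2Eq37RemainingIntegralTower

open HiggsLattice HiggsAveraging HiggsCovariance HiggsCovariancePos HiggsFluctMeasurePos B1Eq27StepAdjoint B1Eq230FluctCov
  HiggsCondCov232 HiggsCondGauss228 B2Eq255Concrete B2Eq227CondDelta B2Eq39ConcreteForms B2Eq37RemainingIntegral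
  B2Eq37QuadraticForm B2Eq32FieldRegularity
open B2Eq228Conditioning (In Out resIn resOut glue)
open B3MultiscaleFields (zeroCharge)
open B2Eq324NestedRegions (prime Tower)
open B2Eq28RegionsCollars (prime_mono)
open B2Eq243RegionsTower (towerRegion towerOf towerOf_lam_of_lt towerOf_lam_of_not_lt towerRegion_antitone
  towerRegion_succ_subset_prime towerRegion_eq_univ_of_no_bad prime_univ)


variable {P : HiggsLattice.Params} {N : ℕ}

/-! ## §1 (3.4): one step of the external field -/

section Field34

variable (θ : ℕ → HiggsLattice.Site P 0 → ℝ) (A : ℕ → HiggsLattice.VecField P 0)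

/-- **(3.4) one step down**: for `k < K`, `Ã^{(k),ε} = (1 − θ_{k+1})θ_kA^{(k),ε} + Ã^{(k+1),ε}` (the two external fields of
(3.7): `Ã⁽ᵏ⁾` in `ρ′⁽ᵏ⁾` and in `Δ⁽ᵏ⁾(Bᵏ(Λ₂′), Ã⁽ᵏ⁾)`, `Ã^{(k+1)}` in the averagings `Q_{l−k}(Ã^{(k+1)})`).
[cite: Balaban1982Higgs2, (3.4) p.583] -/
theorem field34_succ {k K : ℕ} (hk : k < K) (b : HiggsLattice.PBond P 0) :
    field34 θ A k K b = (1 - θ (k + 1) b.src) * θ k b.src * A k b + field34 θ A (k + 1) K b := by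
  simp only [field34]
  rw [Finset.sum_eq_sum_Ico_succ_bot hk]
  ring

/-- **(3.4) at the top scale**: `Ã^{(K),ε} = θ_KA^{(K),ε}` (the sum over `K ≤ l ≤ K − 1` is empty).
[cite: Balaban1982Higgs2, (3.4) p.583] -/
theorem field34_self (K : ℕ) (b : HiggsLattice.PBond P 0) : field34 θ A K K b = θ K b.src * A K b := by
  simp [field34]

end Field34

/-! ## §2 The data of (3.7) on the tower of record -/

variable (P N) in
/-- **The inputs of ONE integral (3.7) on Bałaban's tower**: the number of steps `K ≤ P.K` (*"Λ₅^{(K)} = ∅"*), the level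
`k = j + 1 ≤ K`, the large-field points `bad l ⊂ T^{(l)}` and radii `rad l ↤ r(Lˡε) ≥ 0` of every step ((2.7)–(2.8)/(2.43); the
regions `Λ_i^{(l)} = towerRegion bad rad l i` are then CONSTRUCTED), the cut-offs `θ_l` and minimizers `A^{(l),ε}` of
(2.44)/(3.3) (the fields of (3.4)), and the remaining named data of `Data37`: the fields `A_k, φ_k` (outside `Λ₅⁽ᵏ⁾`),
`A_{k+n}, φ_{k+n}`, the characteristic functions `χ_{k,Λ₅^{(k)c}}`, `χ_{k+n,Λ₅^{(k+n)c}}`/`χ_K`, the density `ρ′⁽ᵏ⁾` and the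
operator `H_k`. [cite: Balaban1982Higgs2, (3.7) p.584, (2.43) p.566, (3.4) p.583] -/
structure TowerInput37 where
  /-- number of steps `K` (`Λ₅^{(K)} = ∅`, (3.23)). [cite: Balaban1982Higgs2, (3.23) p.588] -/
  K : ℕ
  hK : K ≤ P.K
  /-- `k = j + 1`, the level of the integrated fields. [cite: Balaban1982Higgs2, (3.7) p.584] -/
  j : ℕ
  hj : j + 1 ≤ K
  /-- the large-field points of step `l + 1`, on `T^{(l)}`. [cite: Balaban1982Higgs2, (2.7) p.558] -/
  bad : (l : ℕ) → Set (HiggsLattice.Site P l)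
  /-- `r(Lˡε)` in lattice units of `T^{(l)}`. [cite: Balaban1982Higgs2, (2.8) p.558] -/
  rad : ℕ → ℝ
  hrad : ∀ l, 0 ≤ rad l
  /-- the cut-offs `θ_l` on `T_ε` ((2.44)). [cite: Balaban1982Higgs2, (2.44) p.566] -/
  θ : ℕ → HiggsLattice.Site P 0 → ℝ
  /-- the minimizers `A^{(l),ε}` ((3.3)). [cite: Balaban1982Higgs2, (3.3) p.583] -/
  Amin : ℕ → HiggsLattice.VecField P 0
  /-- `A_k` on `T⁽ᵏ⁾`. [cite: Balaban1982Higgs2, (3.7) p.584] -/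
  Ak : ScalarField P (j + 1) P.d
  /-- `φ_k` on `T⁽ᵏ⁾`. [cite: Balaban1982Higgs2, (3.7) p.584] -/
  φk : ScalarField P (j + 1) N
  /-- `A_{k+n}`, `n = 1, …, K − k`. [cite: Balaban1982Higgs2, (3.7) p.584] -/
  A : (n : ℕ) → ScalarField P (j + 1 + n) P.d
  /-- `φ_{k+n}`, `n = 1, …, K − k`. [cite: Balaban1982Higgs2, (3.7) p.584] -/
  φ : (n : ℕ) → ScalarField P (j + 1 + n) N
  /-- `χ_{k,Λ₅^{(k)c}}`. [cite: Balaban1982Higgs2, (3.7) p.584] -/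
  chik : ScalarField P (j + 1) P.d → ScalarField P (j + 1) N → ℝ
  /-- `χ_{k+n,Λ₅^{(k+n)c}}` (`n < K − k`), `χ_K` (`n = K − k`). [cite: Balaban1982Higgs2, (3.7) p.584] -/
  chi : (n : ℕ) → ScalarField P (j + 1 + n) P.d → ScalarField P (j + 1 + n) N → ℝ
  /-- `ρ′⁽ᵏ⁾(Λ₀⁽⁰⁾, …, Λ₀^{(k−1)}, A, Ã, φ)` as a function of `(A, Ã, φ)`. [cite: Balaban1982Higgs2, (2.47) p.568] -/
  rhoP : ScalarField P (j + 1) P.d → HiggsLattice.VecField P 0 → ScalarField P (j + 1) N → ℝ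
  /-- `H_k` ((2.108)). [cite: Balaban1982Higgs2, (2.108) p.580] -/
  Hk : ScalarField P (j + 1) N →ₗ[ℝ] ScalarField P (j + 1) N

namespace TowerInput37

variable (t : TowerInput37 P N)

/-- The §3 tower `Λ₅^{(0)}, …, Λ₅^{(K−1)}, Λ₅^{(K)} = ∅` built from the large-field data (typer g9's `towerOf`).
[cite: Balaban1982Higgs2, (3.22)–(3.23) p.588] -/
abbrev tower : Tower P t.K := towerOf t.bad t.rad t.hrad t.K

/-- **THE DATUM OF (3.7) ON THE TOWER OF RECORD**: geometry `Geom39.ofTower` (`Λ₅⁽ᵏ⁾ = Λ₅^{(j+1)}` of the tower, conditioning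
blocks `Λ₅^{(k−1)′}`, pieces `Λ₅^{(l−1)′} ∖ Λ₅^{(l)}`, `M = K − k`), masks `Λ₆^{(k−1)′} = (Λ₆^{(k−1)})′`, `Λ₇^{(k−1)′} = (Λ₇^{(k−1)})′`, Neumann
region `Bᵏ(Λ₂^{(k−1)′})`, external fields `Ã⁽ᵏ⁾ = field34 θ A k K`, `Ã^{(k+1)} = field34 θ A (k+1) K`; the rest passed through.
[cite: Balaban1982Higgs2, (3.7) p.584, (3.4) p.583, (2.8) p.558] -/
def toData37 : Data37 P N where
  G := Geom39.ofTower t.tower t.hK t.j t.hj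
  R6p := prime (towerRegion t.bad t.rad t.j 6)
  R7p := prime (towerRegion t.bad t.rad t.j 7)
  Ω := underRegion (t.j + 1) (prime (towerRegion t.bad t.rad t.j 2))
  Atk := field34 t.θ t.Amin (t.j + 1) t.K
  Atk1 := field34 t.θ t.Amin (t.j + 2) t.K
  Ak := t.Ak
  φk := t.φk
  A := t.A
  φ := t.φ
  chik := t.chik
  chi := t.chi
  rhoP := t.rhoP
  Hk := t.Hk

/-- The geometry of the datum is `Geom39.ofTower` of the constructed tower (definitional). [cite: Balaban1982Higgs2, (3.9) p.585] -/
theorem toData37_G : t.toData37.G = Geom39.ofTower t.tower t.hK t.j t.hj := rfl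

/-- The level: `k = j + 1` (definitional). [cite: Balaban1982Higgs2, (3.7) p.584] -/
theorem toData37_j : t.toData37.G.j = t.j := rfl

/-- `M = K − k` (definitional). [cite: Balaban1982Higgs2, (3.7) p.584] -/
theorem toData37_M : t.toData37.G.M = t.K - (t.j + 1) := rfl

/-- `Λ₅⁽ᵏ⁾` of the datum is the tower's level-`k` region (definitional). [cite: Balaban1982Higgs2, (3.22) p.588] -/
theorem toData37_Λ5 : t.toData37.G.Λ5 = t.tower.lam (t.j + 1) := rfl

/-- `Λ₅^{(k−1)′}` of the datum is `(Λ₅^{(k−1)})′` of the tower (definitional). [cite: Balaban1982Higgs2, (2.46) p.567] -/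
theorem toData37_Λc : t.toData37.G.Λc = prime (t.tower.lam t.j) := rfl

/-- **`Λ₅⁽ᵏ⁾ = Λ₅^{(k)}` of (2.8) at step `k`, built from the large-field points**, for `k < K`. [cite: Balaban1982Higgs2, (2.8) p.558, (3.22) p.588] -/
theorem Λ5_eq_of_lt (h : t.j + 1 < t.K) : t.toData37.G.Λ5 = towerRegion t.bad t.rad (t.j + 1) 5 :=
  towerOf_lam_of_lt (hr := t.hrad) h

/-- **`Λ₅⁽ᴷ⁾ = ∅`** at the top step `k = K` ((3.23)). [cite: Balaban1982Higgs2, (3.23) p.588] -/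
theorem Λ5_eq_empty_of_eq (h : t.j + 1 = t.K) : t.toData37.G.Λ5 = ∅ :=
  towerOf_lam_of_not_lt (hr := t.hrad) (by omega)

/-- `Λ₆^{(k−1)′}` of the datum (definitional). [cite: Balaban1982Higgs2, (3.7) p.584] -/
theorem toData37_R6p : t.toData37.R6p = prime (towerRegion t.bad t.rad t.j 6) := rfl

/-- `Λ₇^{(k−1)′}` of the datum (definitional). [cite: Balaban1982Higgs2, (3.7) p.584] -/
theorem toData37_R7p : t.toData37.R7p = prime (towerRegion t.bad t.rad t.j 7) := rfl

/-- `Bᵏ(Λ₂^{(k−1)′})` of the datum (definitional). [cite: Balaban1982Higgs2, (3.7) p.584, (2.56) p.570] -/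
theorem toData37_Ω : t.toData37.Ω = underRegion (t.j + 1) (prime (towerRegion t.bad t.rad t.j 2)) := rfl

/-- `x ∈ Bᵏ(Λ₂^{(k−1)′}) ⇔ x_k ∈ Λ₂^{(k−1)′}` (the `Inst.reg`/`underRegion` shape). [cite: Balaban1982Higgs2, (2.56) p.570] -/
theorem mem_Ω (x : HiggsLattice.Site P 0) :
    x ∈ t.toData37.Ω ↔ blockIter (t.j + 1) x ∈ prime (towerRegion t.bad t.rad t.j 2) :=
  mem_underRegion _ _ x

/-- `Ã⁽ᵏ⁾` of the datum is (3.4) at `k` (definitional). [cite: Balaban1982Higgs2, (3.4) p.583] -/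
theorem toData37_Atk : t.toData37.Atk = field34 t.θ t.Amin (t.j + 1) t.K := rfl

/-- `Ã^{(k+1)}` of the datum is (3.4) at `k + 1` (definitional). [cite: Balaban1982Higgs2, (3.4) p.583] -/
theorem toData37_Atk1 : t.toData37.Atk1 = field34 t.θ t.Amin (t.j + 2) t.K := rfl

/-- The two external fields of the datum differ by the `k`-th slice term: `Ã⁽ᵏ⁾ = (1 − θ_{k+1})θ_kA⁽ᵏ⁾ + Ã^{(k+1)}` for `k < K`
((3.4)). [cite: Balaban1982Higgs2, (3.4) p.583] -/
theorem Atk_eq_slice_add_Atk1 (h : t.j + 1 < t.K) (b : HiggsLattice.PBond P 0) :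
    t.toData37.Atk b = (1 - t.θ (t.j + 2) b.src) * t.θ (t.j + 1) b.src * t.Amin (t.j + 1) b + t.toData37.Atk1 b :=
  field34_succ t.θ t.Amin h b

/-! ## §3 The nestings, PROVED for the constructed regions -/

/-- **`Λ₅⁽ᵏ⁾ ⊆ Λ₇^{(k−1)′}`** — the hypothesis of p23 g25's `display37_factor` DISCHARGED: for `k < K` by p. 566 *"Λ₀^{(j+1)} ⊂
Λ₇^{(j)′}"* with (2.8) (typer's `towerRegion_succ_subset_prime`), at `k = K` because `Λ₅⁽ᴷ⁾ = ∅`.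
[cite: Balaban1982Higgs2, (2.43) p.566, (2.8) p.558, (3.23) p.588] -/
theorem Λ5_subset_R7p : t.toData37.G.Λ5 ⊆ t.toData37.R7p := by
  by_cases h : t.j + 1 < t.K
  · rw [t.Λ5_eq_of_lt h, toData37_R7p]
    exact towerRegion_succ_subset_prime (t.hrad (t.j + 1)) 5
  · rw [t.Λ5_eq_empty_of_eq (by have := t.hj; omega)]
    exact Finset.empty_subset _

/-- **`Λ₇^{(k−1)′} ⊆ Λ₆^{(k−1)′}`**: (2.8) `Λ₇ ⊂ Λ₆` at step `k − 1` (typer's `towerRegion_antitone`) and `Λ ⊆ Λ̃ ⇒ Λ′ ⊆ Λ̃′`.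
[cite: Balaban1982Higgs2, (2.8) p.558] -/
theorem R7p_subset_R6p : t.toData37.R7p ⊆ t.toData37.R6p :=
  prime_mono (towerRegion_antitone (t.hrad t.j) (by norm_num))

/-- **`Λ₅⁽ᵏ⁾ ⊆ Λ₆^{(k−1)′}`** — the hypothesis of p23 g26's `exponent37_split`/`display37_gaussian` DISCHARGED.
[cite: Balaban1982Higgs2, (2.8) p.558, (2.43) p.566] -/
theorem Λ5_subset_R6p : t.toData37.G.Λ5 ⊆ t.toData37.R6p :=
  t.Λ5_subset_R7p.trans t.R7p_subset_R6p

/-- `Λ₆^{(k−1)′} ⊆ Λ₂^{(k−1)′}` ((2.8) `Λ₆ ⊂ Λ₂` primed): the masked fields live over the Neumann region's base.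
[cite: Balaban1982Higgs2, (2.8) p.558] -/
theorem R6p_subset_L2p : t.toData37.R6p ⊆ prime (towerRegion t.bad t.rad t.j 2) :=
  prime_mono (towerRegion_antitone (t.hrad t.j) (by norm_num))

/-- **`Bᵏ(Λ₅⁽ᵏ⁾) ⊆ Bᵏ(Λ₂^{(k−1)′})`**: the fine sites under the integrated region lie in the Neumann region of
`Δ⁽ᵏ⁾(Bᵏ(Λ₂^{(k−1)′}), Ã⁽ᵏ⁾)` (`Λ₅⁽ᵏ⁾ ⊆ Λ₇^{(k−1)′} ⊆ Λ₂^{(k−1)′}`). [cite: Balaban1982Higgs2, (3.7) p.584, (2.8) p.558] -/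
theorem under_Λ5_subset_Ω : underRegion (t.j + 1) t.toData37.G.Λ5 ⊆ t.toData37.Ω := by
  intro x hx
  rw [mem_underRegion] at hx
  exact (mem_underRegion _ _ x).mpr ((t.Λ5_subset_R6p.trans t.R6p_subset_L2p) hx)

/-! ## §4 The structural statements of (3.7), UNCONDITIONALLY for Bałaban's runs -/

variable (C : ChargeData N) (μ msq a : ℝ)

/-- **(3.7) WITH THE DENSITY FACTOR OUTSIDE THE INTEGRAL, on the tower of record** (p23 g25's `display37_factor`, its
hypothesis now a theorem): `(3.7) = χ⋯χ · ρ′⁽ᵏ⁾(…, Λ₇′ᶜA_k, Ã⁽ᵏ⁾, Λ₇′ᶜφ_k) · ∫dA_k↾Λ₅∫dφ_k↾Λ₅ exp[lines 1–5]`.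
[cite: Balaban1982Higgs2, (3.7) p.584, (3.9) p.585] -/
theorem display37_factor_tower :
    t.toData37.display37 C μ msq a
      = t.toData37.chiProd37 * t.toData37.rhoP (cutTo t.toData37.R7pᶜ t.Ak) t.toData37.Atk (cutTo t.toData37.R7pᶜ t.φk) *
          ∫ x : In (inSet (P := P) P.d t.toData37.G.Λ5) → ℝ, ∫ x' : In (inSet (P := P) N t.toData37.G.Λ5) → ℝ,
            Real.exp (t.toData37.exponent37 C μ msq a (fld37 t.toData37.G.Λ5 t.Ak x) (fld37 t.toData37.G.Λ5 t.φk x')) :=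
  t.toData37.display37_factor C μ msq a t.Λ5_subset_R7p

/-- **THE EXPONENT OF (3.7) SPLIT, on the tower of record** (p23 g26's `exponent37_split`, its hypothesis now a theorem):
`exponent37(A_k, φ_k) = exponent37(Λ₅ᶜA_k, Λ₅ᶜφ_k) + lin37(x̂, x̂′) − ½·quad37(x̂, x̂′)`. [cite: Balaban1982Higgs2, (3.7) p.584, (3.9) p.585] -/
theorem exponent37_split_tower (x : In (inSet (P := P) P.d t.toData37.G.Λ5) → ℝ)
    (x' : In (inSet (P := P) N t.toData37.G.Λ5) → ℝ) :
    t.toData37.exponent37 C μ msq a (fld37 t.toData37.G.Λ5 t.Ak x) (fld37 t.toData37.G.Λ5 t.φk x')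
      = t.toData37.exponent37 C μ msq a (cutTo t.toData37.G.Λ5ᶜ t.Ak) (cutTo t.toData37.G.Λ5ᶜ t.φk)
        + lin37 C μ msq a t.toData37 (fieldOfCrd t.toData37.G.Λ5 x) (fieldOfCrd t.toData37.G.Λ5 x')
        - (1 / 2 : ℝ) * quad37 C μ msq a t.toData37 (fieldOfCrd t.toData37.G.Λ5 x) (fieldOfCrd t.toData37.G.Λ5 x') :=
  exponent37_split C μ msq a t.toData37 t.Λ5_subset_R6p x x'

/-- **(3.7) AS A GAUSSIAN INTEGRAL IN THE INTERIOR COORDINATES, on the tower of record** (p23 g26's `display37_gaussian`,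
both hypotheses now theorems). [cite: Balaban1982Higgs2, (3.7) p.584, (3.9) p.585] -/
theorem display37_gaussian_tower :
    t.toData37.display37 C μ msq a
      = t.toData37.chiProd37 * t.toData37.rhoP (cutTo t.toData37.R7pᶜ t.Ak) t.toData37.Atk (cutTo t.toData37.R7pᶜ t.φk)
          * Real.exp (t.toData37.exponent37 C μ msq a (cutTo t.toData37.G.Λ5ᶜ t.Ak) (cutTo t.toData37.G.Λ5ᶜ t.φk))
          * ∫ x : In (inSet (P := P) P.d t.toData37.G.Λ5) → ℝ, ∫ x' : In (inSet (P := P) N t.toData37.G.Λ5) → ℝ,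
              Real.exp (lin37 C μ msq a t.toData37 (fieldOfCrd t.toData37.G.Λ5 x) (fieldOfCrd t.toData37.G.Λ5 x')
                - (1 / 2 : ℝ) * quad37 C μ msq a t.toData37 (fieldOfCrd t.toData37.G.Λ5 x) (fieldOfCrd t.toData37.G.Λ5 x')) :=
  display37_gaussian C μ msq a t.toData37 t.Λ5_subset_R7p t.Λ5_subset_R6p

end TowerInput37

/-! ## §5 Non-vacuity -/

variable (P N) in
/-- The trivial input at `K ≤ P.K` steps, level `k = j + 1 ≤ K`: no large field, zero radii, cut-offs and fields, unit
characteristic functions and density, `H_k = 0`. [cite: Balaban1982Higgs2, (3.7) p.584] -/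
def trivialInput {K j : ℕ} (hK : K ≤ P.K) (hj : j + 1 ≤ K) : TowerInput37 P N where
  K := K
  hK := hK
  j := j
  hj := hj
  bad := fun _ => ∅
  rad := fun _ => 0
  hrad := fun _ => le_rfl
  θ := fun _ _ => 0
  Amin := fun _ => 0
  Ak := 0
  φk := 0
  A := fun _ => 0
  φ := fun _ => 0
  chik := fun _ _ => 1
  chi := fun _ _ _ => 1
  rhoP := fun _ _ _ => 1
  Hk := 0

/-- The input type is inhabited at every admissible `(K, k)`. [cite: Balaban1982Higgs2, (3.7) p.584] -/
theorem exists_towerInput37 {K j : ℕ} (hK : K ≤ P.K) (hj : j + 1 ≤ K) :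
    ∃ t : TowerInput37 P N, t.K = K ∧ t.j = j :=
  ⟨trivialInput P N hK hj, rfl, rfl⟩

/-- **With no large field at any step the integrated region is the whole lattice**: `Λ₅⁽ᵏ⁾ = T⁽ᵏ⁾` for `k < K` (typer's
`towerRegion_eq_univ_of_no_bad`). [cite: Balaban1982Higgs2, (2.43) p.566, (3.22) p.588] -/
theorem Λ5_eq_univ_of_no_bad (t : TowerInput37 P N) (hbad : ∀ l, t.bad l = ∅) (h : t.j + 1 < t.K) :
    t.toData37.G.Λ5 = Finset.univ := by
  rw [t.Λ5_eq_of_lt h]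
  exact towerRegion_eq_univ_of_no_bad hbad (t.j + 1) 5

end Literature.MathematicalPhysics.QuantumFieldTheory.Balaban1983to89.B2Eq37RemainingIntegralTower

end
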